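import Literature.NumberTheory.EllipticCurves.ComplexMultiplicationBurungaleFlachAssemblyProofs
import HarnessLib

/-!
# bsd.S28 (Burungale–Flach): the trust base of Theorem 1.1 over the CM field

Seventh proof file of `Literature.NumberTheory.EllipticCurves.ComplexMultiplication` for
**bsd.S28**; sibling of `ComplexMultiplicationBurungaleFlachAssemblyProofs.lean`. That file
composes the reductions of the tree into one theorem exhibiting the eleven named facts on which
the *route target* bsd.S28 rests. This file does the same bookkeeping — and adds no mathematics —
for the **transcription of the paper itself** at `F = K`, which is the object a discharge of
Burungale–Flach, Camb. J. Math. 12 (2024), Thm. 1.1 would have to reach: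

* `BurungaleFlach2024_main_cmField_of_leaves` : the level-3 leaf
  `Literature.NumberTheory.EllipticCurves.BurungaleFlach2024_main_cmField` (Thm. 1.1 with
  Remark 1 at `F = K`; the printed proof on arXiv p. 22 establishes it prime by prime: Prop. 4.1
  for the finiteness of `E(K)` and `Ш(E/K)[p^∞]`, Prop. 2.3 applied to the zeta element of
  Lemma 13 for the `{𝔭 ∣ p}`-part of the formula, and the last sentence for the passage to the
  identity of fractional ideals and the finiteness of `Ш(E/K)`, proved as
  `BurungaleFlach2024_main_cmField_of_halves`) follows, sorry-free, from **eight** of the eleven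
  leaves:
  1. `BurungaleFlach2024_main_cmField_pPart` — Prop. 2.3 with Lemma 13 at `F = K` for every
     rational prime `p` (two-variable main conjecture of Johnson-Leung–Kings, its descent
     Prop. 4.1 through Lemma 9, Kato's explicit reciprocity law Prop. 3.1; for `𝔭 ∤ #𝓞_K^×`
     also Rubin 1991, Thm. 11.1, as the introduction, arXiv p. 3, records) — the paper's own
     contribution and the only leaf of Iwasawa-theoretic content;
  2. `Rubin1987_sha_primary_finite` — Rubin 1987, §10 (`Ш(E_K/K)[p^∞]` finite), which the paper
     names in Remark 10 (arXiv p. 19) as the classical source of the finiteness it re-proves in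
     Prop. 4.1;
  3. `CoatesWiles1977_L_one_div_period_mem_prime` — Coates–Wiles 1977, §6 (finiteness of `E(ℚ)`,
     Remark 10 again), with
  4. `singularModuli_classNumberOne_three` — the three singular moduli `d_K = -43, -67, -163`
     feeding the CM period lattice used by the Coates–Wiles reduction;
  5. `hasEntireLFunction_rat` — modularity (`L(E/ℚ,s)` entire), to speak of `L(E_K/K,1)`;
  6. `LSeries_baseChange_quadratic` — Artin formalism `L(E_K/K,s) = L(E,s)·L(E^{(d_K)},s)`;
  7. `WeierstrassCurve.hasseWeilEulerFactor_geomPoints` — the Euler factors of the Tate module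
     (whence Knapp 11.67, `L` is an isogeny invariant);
  8. `isIsogenous_quadraticTwist_cmFieldDiscr_models` — the six explicit `ℚ`-isogenies
     `E ∼ E^{(d_K)}` (Milne 1972, Thm. 3), which with 6 and 7 give Deuring's
     `L(E_K/K,s) = L(E/ℚ,s)²` and, with 3, the finiteness of `E^{(d_K)}(ℚ)`, hence of `E(K)`.
  The three remaining leaves of bsd.S28 (Milne 1972 Thm. 1 for the Weil restriction, Cassels'
  isogeny invariance of the BSD quotient, `L(E,1) ≥ 0`) serve only the descent from `K` to `ℚ`
  (Cor. 1 ⇒ Cor. 2) and do not enter.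

Size of an absolute discharge (recorded for the planner; nothing below is in Mathlib or the tree
as of this file): leaf 1 needs, even to *state* its next level (Prop. 2.3, Lemma 13, Prop. 4.1 as
printed), the étale cohomology `RΓ(𝓞_{F,S}, T_p E)` as a perfect complex of `𝓞_{K_p}`-modules with
the Knudsen–Mumford determinant functor, the dual exponential map of `p`-adic Hodge theory and the
period isomorphism, the Iwasawa algebra `ℤ_p⟦G_{p^∞𝔣}⟧` with its Iwasawa cohomology, elliptic
units and the zeta elements `z_{p^∞𝔣}`; leaves 2, 3, 5 are theories of comparable size
(Euler system of elliptic units; `p`-adic `L`-functions and explicit reciprocity; modularity).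

## Design and faithfulness notes

* Nothing is restated and no statement of the tree is edited: hypotheses are existing named facts
  of the tree, conclusions are literally the two existing leaves; the proofs are compositions of
  reductions already proved in the sibling files (`…_of_halves`, `…_of_classical`,
  `…_of_mem_prime_of_singularModuli`, `…_of_artinFormalism`, `…_of_hasseWeilEulerFactor_geomPoints`,
  `…_of_models`, `…_of_three`, `…_of_halves`).
* Group rules of the topic: `noncomputable section`, `open scoped Classical`,
  `namespace Literature.NumberTheory.EllipticCurves`.

## References

* A. Burungale, M. Flach, *The conjecture of Birch and Swinnerton-Dyer for certain elliptic curves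
  with complex multiplication*, Camb. J. Math. 12 (2024), no. 2 (arXiv:2206.09874): Thm. 1.1 and
  Remark 1 (p. 3), the introduction (p. 3, attribution to Rubin 1991 for `𝔭 ∤ #𝓞_K^×`),
  Prop. 2.3 (p. 12), Prop. 4.1 and Remark 10 (p. 19), Lemma 13 and the proof of Thm. 1.1 (p. 22).
  [BurungaleFlach2024]
* the sources of the eight leaves, cited at their definitions.
-/

noncomputable section

open scoped Classical

namespace Literature.NumberTheory.EllipticCurves

open WeierstrassCurve

/-- **Burungale–Flach, Thm. 1.1 with Remark 1 at `F = K` (the level-3 leaf), from the eight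
current leaves of its decomposition** (see the module docstring for the list and the provenance
of each): Prop. 2.3 with Lemma 13 at `F = K` (`hB`), Rubin 1987 §10 (`hR`), Coates–Wiles 1977 §6
(`h1`), the three singular moduli `d_K = -43, -67, -163` (`h3`), modularity (`hmod`), Artin
formalism (`hBCL`), the Euler factors of the Tate module (`hHW`) and the six CM twist isogenies
(`hTW₆`); the finiteness half is the classical one of Remark 10
(`BurungaleFlach2024_finite_primary_cmField_of_classical`), the formula half is `hB`, and the two
halves give the leaf by the proved last sentence of the printed proof, *"Since it was shown in
Prop. (descent) that the `p`-primary part of `Ш(E/F)` (and of `E(F)`) is finite for any prime `p`,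
the finiteness of `Ш(E/F)` follows from the global formula for its cardinality given by
Prop. (keyelliptic)"* (`BurungaleFlach2024_main_cmField_of_halves`).
[cite: BurungaleFlach2024, Thm. 1.1 and Remark 1 (arXiv p. 3), proof of Thm. 1.1 (p. 22) with Prop. 2.3, Prop. 4.1, Remark 10, Lemma 13] -/
theorem BurungaleFlach2024_main_cmField_of_leaves
    (hB : BurungaleFlach2024_main_cmField_pPart) (hR : Rubin1987_sha_primary_finite)
    (h1 : CoatesWiles1977_L_one_div_period_mem_prime) (h3 : singularModuli_classNumberOne_three)
    (hmod : hasEntireLFunction_rat) (hBCL : LSeries_baseChange_quadratic)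
    (hHW : ∀ (W : WeierstrassCurve ℚ) [W.IsElliptic] (ℓ : ℕ) [Fact ℓ.Prime],
      W.hasseWeilEulerFactor_geomPoints ℓ)
    (hTW₆ : isIsogenous_quadraticTwist_cmFieldDiscr_models) :
    BurungaleFlach2024_main_cmField :=
  have hS : singularModuli_classNumberOne := singularModuli_classNumberOne_of_three h3
  have hKn : LFunction_eq_of_isIsogenous :=
    LFunction_eq_of_isIsogenous_of_hasseWeilEulerFactor_geomPoints hHW
  have hTW : isIsogenous_quadraticTwist_cmFieldDiscr :=
    isIsogenous_quadraticTwist_cmFieldDiscr_of_models hTW₆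
  BurungaleFlach2024_main_cmField_of_halves
    (BurungaleFlach2024_finite_primary_cmField_of_classical
      (finite_point_of_j_mem_maximalCMJInvariants_of_L_one_ne_zero_of_mem_prime_of_singularModuli
        h1 hS)
      hTW hKn hR (Deuring_LFunction_baseChange_cmField_of_artinFormalism hBCL hTW hKn) hmod)
    hB


end Literature.NumberTheory.EllipticCurves

end
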